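import Literature.AlgebraicGeometry.ShimuraVarieties.UnitaryShimuraLevelQuotient
import Literature.AlgebraicGeometry.ShimuraVarieties.UnitaryShimuraCanonicalModelHeckeHolds
import Literature.AlgebraicGeometry.Motives.SepQuotientComparisonComplex
import Literature.AlgebraicGeometry.Motives.VarietiesGeometricallyIntegralProofs
import HarnessLib

/-!
# `M_K = M_N / (K/N)` for the levels of Deligne's canonical model — [Deligne1979ShimuraVarieties] 2.7.1 (c) PROVED for the record

Topic `AlgebraicGeometry/ShimuraVarieties`, namespace `Literature.AlgebraicGeometry.ShimuraVarieties.UnitaryCanonicalModel`.  PROOF FILE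
(theorems only; no definition, no named fact, no instance, no `sorry`): the named fact `levelQuotient_printed` of
`UnitaryShimuraLevelQuotient.lean` ([Deligne1979ShimuraVarieties] 2.7.1 (c) «`(K/L)\S_L ⥲ S_K`» for the record system of Deligne's canonical
model of `Sh(U(H), 𝔹²)`; [Milne2005ShimuraVarieties] Rem. 5.29 (c)) is a THEOREM of the record's fields (F1) smooth projective,
(F2a) `pts`, `map_pts`, (F2c) `pieces` together with the tree's PROVED U7 `heckeTranslate_definedOver_holds` ([Milne2005ShimuraVarieties] Thm. 13.6).

PROOF (`RecordSystem.isLevelQuotient`).  Let `N ≤ K ≤ K₀` be small levels with `N` normal in `K`, `p : M_N → M_K` the transition morphism.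
* (E1) `K` acts on `M_N` by `act k := T_{k⁻¹}`, the Hecke translate `[z, aN] ↦ [z, ak⁻¹N]` defined over `L` (U7; `k N k⁻¹ = N`), a homomorphism
  `K → Aut_L(M_N)` by the uniqueness of translates (`heckeTranslate_unique`, `isHeckeTranslate_comp`, `heckeTranslate_eq_id_of_mem`); it kills
  `N`, so factors through the FINITE group `Δ = K/N` (`N` open in the compact `K`).
* (E2) `p` is invariant: `T_{k⁻¹} ≫ p` and `p` are both translates `M_N → M_K` for `k⁻¹` (`[z, ak⁻¹K] = [z, aK]`), hence equal.
* (E3) Let `π : M_N → Q := M_N / Δ` be Mumford's quotient of the projective `M_N` (tree `Motives.autQuotient`) and `r : Q → M_K` the factorisation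
  of `p` (`autQuotient.desc`).  It suffices that `r` is an isomorphism (`isSepQuotient_of_isIso_desc`), and by fpqc descent it suffices that
  `r ⊗_{L,τ} ℂ` is (`isIso_of_isIso_baseChangeHom_map`, [StacksProject, Tag 02L4]).
* (C) Over `ℂ`: `(M_K)_τ` is the coproduct of the smooth projective ball quotients `X_q` (field `pieces`), `Q_τ = (M_N)_τ/Δ` is proper and reduced
  (`isReduced_baseChangeHom_autQuotient_left`), and `r_τ` is BIJECTIVE on complex points — pure `Sh(ℂ) = G(ℚ)\[𝔹² × G(𝔸_f)/K]` bookkeeping: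
  every complex point of `Q_τ` is `π_τ [z, aN]` (`map_baseChangeHom_autQuotientMk_surjective`), `r_τ π_τ = p_τ` acts by `[z, aN] ↦ [z, aK]`
  (`map_pts`), which is onto, and `[z, aK] = [z', a'K]` forces `[z', a'N] = T_k [z, aN]` for some `k ∈ K` (`ShimuraSet.mk_eq_mk_iff`), so the
  fibres of `p_τ` are `Δ`-orbits, on which `π_τ` is constant.  Hence `r_τ` is an isomorphism by the Zariski-Main-Theorem criterion over the
  pieces (`Motives.isIso_of_bijective_of_isColimit_cofan`, [Springer1998] Thm. 5.2.8).
Then `levelQuotient_printed_holds : levelQuotient_printed` (binders of the named fact verbatim).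

Use (cell `hodgecm-mathlib`, rows VI-4 `HonestIsogenyDescent` ∕ VI-6): discharges the hypothesis `(hQ : levelQuotient_printed)` of
`Summits/…/HypLiu418/A3Liu418HonestIsogenyDescent.lean` (B-p07) by name — item (1) of [Liu2021, Thm. 4.18] then rests on the Albanese trace
`AlbaneseTraceOfFiniteQuotient` alone.  HC_CM is NOT proved here.

## References
* [Deligne1979ShimuraVarieties] P. Deligne, *Variétés de Shimura*, PSPM XXXIII.2 (1979): 2.1.2–2.1.4, 2.2.5, 2.7.1 (c).
* [Milne2005ShimuraVarieties] J. S. Milne, *Introduction to Shimura varieties* (2005): Lemma 5.13 p. 57, Rem. 5.29 (c) p. 65, Thm. 13.6 p. 118.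
* [MumfordAV1970] D. Mumford, *Abelian Varieties* (1970), §7 Thm. p. 66 and Remark.
* [StacksProject] Tag 02L4; [Springer1998] T. A. Springer, *Linear Algebraic Groups*, Thm. 5.2.8.
-/

set_option autoImplicit false

noncomputable section

open Function MulAction Topology NumberField CategoryTheory CategoryTheory.Limits Matrix AlgebraicGeometry
open scoped Matrix ComplexOrder
open Literature.AlgebraicGeometry.Motives
open Literature.NumberTheory.Automorphic Literature.NumberTheory.Automorphic.UnitaryGroup
open Literature.NumberTheory.Automorphic.Liu2021.AppendixC (C5.OpenCompactSubgroup C5.SmallLevel)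
open Literature.Geometry.ComplexHyperbolic Literature.Geometry.ComplexHyperbolic.BallModel
open Literature.NumberTheory.Automorphic.ShimuraDissection

namespace Literature.AlgebraicGeometry.ShimuraVarieties.UnitaryCanonicalModel

variable {L : Type} [Field L] [NumberField L] [IsCMField L] {H : Matrix (Fin 3) (Fin 3) L}
  {τ : L →+* ℂ} {T : GL (Fin 3) ℂ} {hT : formCongr (starRingEnd ℂ) T (H.map τ) = BallModel.J}
  {K₀ : C5.OpenCompactSubgroup ↥(finAdelic (↥(maximalRealSubfield L)) L (IsCMField.complexConj L) 3 H)}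

/-! ## §0 Complex points of the models along `τ` and their base change -/

omit [NumberField L] [IsCMField L] in
/-- Naturality of `X(ℂ) ⥲ X_τ(ℂ)` (`AlgPoints.baseChangeEquiv`) in the `L`-scheme `X`: `(x ≫ f)_τ = x_τ ≫ f_τ` (pullback extensionality;
same proof as the tree's `HodgeTheory.baseChangeEquiv_symm_map`). [cite: GortzWedhorn2020, §(4.7) eq. (4.7.1)] -/
private theorem baseChangeEquiv_map' {X Y : SchemeOver L} (f : X ⟶ Y) (x : letI := τ.toAlgebra; ComplexPoints X) :
    (letI := τ.toAlgebra
     AlgPoints.baseChangeEquiv τ Y (AlgPoints.map f x) = AlgPoints.map ((baseChangeHom τ).map f) (AlgPoints.baseChangeEquiv τ X x)) := by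
  letI : Algebra L ℂ := τ.toAlgebra
  rw [Equiv.apply_eq_iff_eq_symm_apply]
  apply Over.OverMorphism.ext
  rw [AlgPoints.baseChangeEquiv_symm_apply_left, AlgPoints.map_apply, Over.comp_left, AlgPoints.map_apply, Over.comp_left,
    Category.assoc, baseChangeHom_map_left_comp_fst, ← Category.assoc, AlgPoints.baseChangeEquiv_apply_left_comp_fst]
  rfl

/-- **Every complex point of `(M_K)_τ` is `[z, aK]`** (the record's `pts_K : M_K(ℂ) ≃ₜ Sh_K(ℂ)` and `ShimuraSet.mk_surjective`, moved to the
base change by `AlgPoints.baseChangeEquiv`). [cite: Milne2005ShimuraVarieties, Lemma 5.13 p. 57] -/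
theorem RecordSystem.exists_eq_baseChangeEquiv_pts_symm_mk (S : RecordSystem L H τ T hT K₀) (K : C5.SmallLevel K₀)
    (y : ComplexPoints ((baseChangeHom τ).obj (S.M.obj K))) :
    letI := τ.toAlgebra
    ∃ (z : Ball) (a : finAdelic (↥(maximalRealSubfield L)) L (IsCMField.complexConj L) 3 H),
      y = AlgPoints.baseChangeEquiv τ (S.M.obj K) ((S.pts K).symm (ShimuraSet.mk L H τ T hT K.1.1 z a)) := by
  letI : Algebra L ℂ := τ.toAlgebra
  obtain ⟨y₀, rfl⟩ := (AlgPoints.baseChangeEquiv τ (S.M.obj K)).surjective y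
  obtain ⟨⟨z, a⟩, hza⟩ := ShimuraSet.mk_surjective L H τ T hT K.1.1 (S.pts K y₀)
  refine ⟨z, a, ?_⟩
  have hy₀ : y₀ = (S.pts K).symm (ShimuraSet.mk L H τ T hT K.1.1 z a) := by
    rw [← Homeomorph.symm_apply_apply (S.pts K) y₀, ← hza]; rfl
  rw [hy₀]

/-- **A translate `T_g : M_K ⟶ M_{K'}` acts on the base-changed points as `[z, aK] ↦ [z, agK']`.**
[cite: Milne2005ShimuraVarieties, §13 p. 118 L21–26] -/
theorem RecordSystem.IsHeckeTranslate.map_baseChange {S : RecordSystem L H τ T hT K₀} {K K' : C5.SmallLevel K₀}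
    {g : finAdelic (↥(maximalRealSubfield L)) L (IsCMField.complexConj L) 3 H} {Tg : S.M.obj K ⟶ S.M.obj K'}
    (h : S.IsHeckeTranslate K K' g Tg) (z : Ball) (a : finAdelic (↥(maximalRealSubfield L)) L (IsCMField.complexConj L) 3 H) :
    letI := τ.toAlgebra
    AlgPoints.map ((baseChangeHom τ).map Tg) (AlgPoints.baseChangeEquiv τ (S.M.obj K) ((S.pts K).symm (ShimuraSet.mk L H τ T hT K.1.1 z a))) =
      AlgPoints.baseChangeEquiv τ (S.M.obj K') ((S.pts K').symm (ShimuraSet.mk L H τ T hT K'.1.1 z (a * g))) := by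
  letI : Algebra L ℂ := τ.toAlgebra
  rw [← baseChangeEquiv_map', ← h z a, Homeomorph.symm_apply_apply]

/-! ## §1 The theorem -/

set_option maxHeartbeats 1600000 in -- large adelic / Shimura-set terms
/-- **[Deligne1979ShimuraVarieties] 2.7.1 (c) for the record: `M_K = M_N/(K/N)`** — every record system of Deligne's canonical model of the
compact unitary Shimura surface `Sh(U(H), 𝔹²)` (under the hypotheses of `exists_recordSystem`) satisfies `RecordSystem.IsLevelQuotient`: for
small levels `N ≤ K` with `N` normal in `K`, `K` acts on `M_N` through the Hecke translates `T_{k⁻¹}` (U7, PROVED: `heckeTranslate_definedOver_holds`)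
and the transition morphism `M_N ⟶ M_K` is the quotient by this action for separated test objects.  Proof in the module docstring:
comparison with Mumford's quotient `M_N/(K/N)`, fpqc descent of «isomorphism» to `ℂ`, and over `ℂ` the double-coset bookkeeping
`Sh_K(ℂ) = Sh_N(ℂ)/(K/N)` plus Zariski's Main Theorem over the ball-quotient pieces.
[cite: Deligne1979ShimuraVarieties, 2.7.1 (c) (PDF p. 47 L34–38) and 2.1.2–2.1.4] [cite: Milne2005ShimuraVarieties, Rem. 5.29 (c) p. 65; Lemma 5.13 p. 57; Thm. 13.6 p. 118]
[cite: MumfordAV1970, §7 Thm. p. 66 (Remark)] -/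
theorem RecordSystem.isLevelQuotient
    (hpos : ∀ τ' : L →+* ℂ, InfinitePlace.mk τ' ≠ InfinitePlace.mk τ → (H.map τ').PosDef)
    (hanis : ∀ v : Fin 3 → L, hermForm (cmConjRingHom L) H v v = 0 → v = 0)
    (htf : ∀ g : finAdelic (↥(maximalRealSubfield L)) L (IsCMField.complexConj L) 3 H,
      ∀ γ ∈ arithmeticLevel (↥(maximalRealSubfield L)) L (IsCMField.complexConj L) 3 H
        (K₀.1.map (MulAut.conj g).toMonoidHom), IsOfFinOrder γ → γ = 1)
    (S : RecordSystem L H τ T hT K₀) : S.IsLevelQuotient := by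
  intro N K h hNK
  letI : Algebra L ℂ := τ.toAlgebra
  classical
  -- notation
  let G := finAdelic (↥(maximalRealSubfield L)) L (IsCMField.complexConj L) 3 H
  let Kg : Subgroup G := K.1.1
  let Ng : Subgroup Kg := N.1.1.subgroupOf K.1.1
  have hmemNg : ∀ x : Kg, x ∈ Ng ↔ (x : G) ∈ N.1.1 := fun x => Subgroup.mem_subgroupOf
  haveI hNn : Ng.Normal := ⟨fun n hn' g => by
    rw [hmemNg] at hn' ⊢
    have h1 := hNK ((g⁻¹ : Kg) : G) (g⁻¹).2 (n : G) hn'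
    simpa only [Subgroup.coe_inv, inv_inv, Subgroup.coe_mul] using h1⟩
  haveI : CompactSpace Kg := isCompact_iff_compactSpace.1 K.1.2.2
  have hNo : IsOpen (Ng : Set Kg) := N.1.2.1.preimage continuous_subtype_val
  haveI : Finite (Kg ⧸ Ng) := Subgroup.quotient_finite_of_isOpen Ng hNo
  letI : Fintype (Kg ⧸ Ng) := Fintype.ofFinite _
  have hinv : ∀ {k : G}, k ∈ K.1.1 → k⁻¹ ∈ K.1.1 := fun hk => K.1.1.inv_mem hk
  -- (E1) the translates `T_{k⁻¹}`, `k ∈ K`, defined over `L` (U7, proved)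
  have hex : ∀ k : Kg, ∃ Tk : S.M.obj N ⟶ S.M.obj N, S.IsHeckeTranslate N N ((k : G)⁻¹) Tk := fun k =>
    S.exists_heckeTranslate heckeTranslate_definedOver_holds hpos hanis htf ((k : G)⁻¹) N N
      (fun n hn => hNK _ (hinv k.2) n hn)
  choose Tr hTr using hex
  have hTr1 : ∀ (k : Kg), (k : G) ∈ N.1.1 → Tr k = 𝟙 (S.M.obj N) := fun k hk =>
    S.heckeTranslate_eq_id_of_mem (N.1.1.inv_mem hk) (hTr k)
  have hTrmul : ∀ a b : Kg, Tr (a * b) = Tr b ≫ Tr a := fun a b => by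
    refine S.heckeTranslate_unique (hTr (a * b)) ?_
    have e : (((a * b : Kg) : G))⁻¹ = ((b : G))⁻¹ * ((a : G))⁻¹ := by rw [Subgroup.coe_mul, _root_.mul_inv_rev]
    rw [e]
    exact S.isHeckeTranslate_comp (hTr b) (hTr a)
  have hTrone : Tr 1 = 𝟙 (S.M.obj N) := hTr1 1 (by rw [Subgroup.coe_one]; exact N.1.1.one_mem)
  have hTT : ∀ k : Kg, Tr k ≫ Tr k⁻¹ = 𝟙 (S.M.obj N) := fun k => by rw [← hTrmul, inv_mul_cancel, hTrone]
  have hTT' : ∀ k : Kg, Tr k⁻¹ ≫ Tr k = 𝟙 (S.M.obj N) := fun k => by rw [← hTrmul, mul_inv_cancel, hTrone]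
  let act : Kg →* Aut (S.M.obj N) :=
    { toFun := fun k => ⟨Tr k, Tr k⁻¹, hTT k, hTT' k⟩
      map_one' := Iso.ext hTrone
      map_mul' := fun a b => Iso.ext (hTrmul a b) }
  have act_hom : ∀ k : Kg, (act k).hom = Tr k := fun _ => rfl
  -- it kills `N`: descend to the finite group `Δ = K/N`
  have hker : ∀ n ∈ Ng, act n = 1 := fun n hn' => Iso.ext (by rw [act_hom]; exact hTr1 n ((hmemNg n).1 hn'))
  let actΔ : (Kg ⧸ Ng) →* Aut (S.M.obj N) := QuotientGroup.lift Ng act hker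
  have actΔ_mk : ∀ k : Kg, actΔ (QuotientGroup.mk k) = act k := fun _ => rfl
  -- (E2) the transition morphism `p : M_N → M_K` is invariant
  let p : S.M.obj N ⟶ S.M.obj K := S.M.map (homOfLE h)
  have hp1 : S.IsHeckeTranslate N K 1 p := S.isHeckeTranslate_one_map (homOfLE h)
  have hinvK : ∀ k : Kg, (act k).hom ≫ p = p := by
    intro k
    refine S.heckeTranslate_unique (S.isHeckeTranslate_comp (hTr k) hp1) ?_
    intro z a
    rw [hp1 z a, mul_one, mul_one, shimuraSet_mk_mul_of_mem K.1.1 z a (hinv k.2)]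
  have hinvΔ : ∀ g : Kg ⧸ Ng, (actΔ g).hom ≫ p = p := fun g => by
    obtain ⟨k, rfl⟩ := QuotientGroup.mk_surjective g
    exact hinvK k
  -- (E3) Mumford's quotient `Q = M_N/Δ` and the comparison `r : Q → M_K`
  have hY : IsProjectiveOver (S.M.obj N) := S.projective N
  have hZ : IsSeparated (S.M.obj K).hom := by
    haveI := (S.projective K).isProper; infer_instance
  let r := autQuotient.desc actΔ hY p hZ hinvΔ
  have hπr : autQuotient.mk actΔ hY ≫ r = p := autQuotient.mk_desc actΔ hY p hZ hinvΔ
  -- it suffices that `r ⊗_τ ℂ` is an isomorphism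
  suffices hiso : IsIso ((baseChangeHom τ).map r) by
    haveI : IsIso r := isIso_of_isIso_baseChangeHom_map τ r
    have hq : IsSepQuotient (fun g => actΔ g) p := isSepQuotient_of_isIso_desc hY actΔ p hZ hinvΔ
    refine ⟨act, fun k => hTr k, ⟨fun k => hinvK k, fun W f hW hf => hq.2 W f hW fun g => ?_⟩⟩
    obtain ⟨k, rfl⟩ := QuotientGroup.mk_surjective g
    exact hf k
  -- (C) over `ℂ`: instances for `Q_τ`, `(M_N)_τ`, `(M_K)_τ`
  haveI := smoothOfRelativeDimension_isStableUnderBaseChange (n := 2)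
  haveI hsmN : SmoothOfRelativeDimension 2 ((baseChangeHom τ).obj (S.M.obj N)).hom := by
    change SmoothOfRelativeDimension 2 (pullback.snd (S.M.obj N).hom (Spec.map (CommRingCat.ofHom τ)))
    exact MorphismProperty.pullback_snd _ _ (S.smooth N)
  haveI : Smooth ((baseChangeHom τ).obj (S.M.obj N)).hom := SmoothOfRelativeDimension.smooth 2 _
  haveI : IsReduced ((baseChangeHom τ).obj (S.M.obj N)).left := isReduced_of_smooth_over_field ((baseChangeHom τ).obj (S.M.obj N)).hom
  haveI : IsReduced ((baseChangeHom τ).obj (autQuotient actΔ hY)).left := isReduced_baseChangeHom_autQuotient_left τ hY actΔ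
  haveI : IsProper ((baseChangeHom τ).obj (autQuotient actΔ hY)).hom := by
    haveI := autQuotient.isProper_hom actΔ hY
    change IsProper (pullback.snd (autQuotient actΔ hY).hom (Spec.map (CommRingCat.ofHom τ)))
    infer_instance
  haveI : IsSeparated ((baseChangeHom τ).obj (S.M.obj K)).hom :=
    isSeparated_baseChangeHom_hom_of_isProjectiveOver τ (S.projective K)
  -- the pieces of `(M_K)_τ`
  obtain ⟨gK, hgK, X, ι, hcol, B, hB⟩ := S.pieces K
  -- complex points: `r_τ ∘ π_τ = p_τ`; `p_τ [z, aN] = [z, aK]`; `T_τ [z, aN] = [z, a k⁻¹ N]`; `π_τ` onto and invariant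
  have hcomp : (baseChangeHom τ).map (autQuotient.mk actΔ hY) ≫ (baseChangeHom τ).map r = (baseChangeHom τ).map p := by
    rw [← Functor.map_comp, hπr]
  have hpτ : ∀ (z : Ball) (a : G), AlgPoints.map ((baseChangeHom τ).map p)
      (AlgPoints.baseChangeEquiv τ (S.M.obj N) ((S.pts N).symm (ShimuraSet.mk L H τ T hT N.1.1 z a))) =
      AlgPoints.baseChangeEquiv τ (S.M.obj K) ((S.pts K).symm (ShimuraSet.mk L H τ T hT K.1.1 z a)) := fun z a => by
    rw [hp1.map_baseChange, mul_one]
  have hTτ : ∀ (k : Kg) (z : Ball) (a : G), AlgPoints.map ((baseChangeHom τ).map (act k).hom)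
      (AlgPoints.baseChangeEquiv τ (S.M.obj N) ((S.pts N).symm (ShimuraSet.mk L H τ T hT N.1.1 z a))) =
      AlgPoints.baseChangeEquiv τ (S.M.obj N) ((S.pts N).symm (ShimuraSet.mk L H τ T hT N.1.1 z (a * (k : G)⁻¹))) :=
    fun k z a => (hTr k).map_baseChange z a
  have hπinv : ∀ k : Kg, (baseChangeHom τ).map (act k).hom ≫ (baseChangeHom τ).map (autQuotient.mk actΔ hY) =
      (baseChangeHom τ).map (autQuotient.mk actΔ hY) := fun k => by
    rw [← Functor.map_comp, ← actΔ_mk, autQuotient.hom_mk]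
  have hπsurj := map_baseChangeHom_autQuotientMk_surjective τ hY actΔ
  -- `r_τ` is bijective on complex points
  have hbij : Function.Bijective (AlgPoints.map (L := ℂ) ((baseChangeHom τ).map r)) := by
    constructor
    · intro a₁ a₂ h₁₂
      obtain ⟨P₁, rfl⟩ := hπsurj a₁
      obtain ⟨P₂, rfl⟩ := hπsurj a₂
      obtain ⟨z₁, b₁, rfl⟩ := S.exists_eq_baseChangeEquiv_pts_symm_mk N P₁
      obtain ⟨z₂, b₂, rfl⟩ := S.exists_eq_baseChangeEquiv_pts_symm_mk N P₂
      -- `[z₁, b₁K] = [z₂, b₂K]`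
      have hK : ShimuraSet.mk L H τ T hT K.1.1 z₁ b₁ = ShimuraSet.mk L H τ T hT K.1.1 z₂ b₂ := by
        have h' := h₁₂
        rw [← AlgPoints.map_comp_apply, ← AlgPoints.map_comp_apply, hcomp, hpτ, hpτ] at h'
        exact (S.pts K).symm.injective ((AlgPoints.baseChangeEquiv τ (S.M.obj K)).injective h')
      obtain ⟨γ, hγz, hγk⟩ := (ShimuraSet.mk_eq_mk_iff L H τ T hT K.1.1 z₁ z₂ b₁ b₂).mp hK
      -- `k := b₁⁻¹ φ(γ) b₂ ∈ K` and `[z₂, b₂N] = T_k [z₁, b₁N] = act k⁻¹ [z₁, b₁N]`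
      let k : Kg := ⟨b₁⁻¹ * (rationalToFinAdelic _ L _ 3 H γ * b₂), hγk⟩
      have hN : ShimuraSet.mk L H τ T hT N.1.1 z₂ b₂ =
          ShimuraSet.mk L H τ T hT N.1.1 z₁ (b₁ * (((k⁻¹ : Kg) : G))⁻¹) := by
        rw [Subgroup.coe_inv, inv_inv]
        change ShimuraSet.mk L H τ T hT N.1.1 z₂ b₂ =
          ShimuraSet.mk L H τ T hT N.1.1 z₁ (b₁ * (b₁⁻¹ * (rationalToFinAdelic _ L _ 3 H γ * b₂)))
        rw [mul_inv_cancel_left, eq_comm, ShimuraSet.mk_eq_mk_iff]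
        exact ⟨γ, hγz, by rw [inv_mul_cancel]; exact N.1.1.one_mem⟩
      have hP : AlgPoints.baseChangeEquiv τ (S.M.obj N) ((S.pts N).symm (ShimuraSet.mk L H τ T hT N.1.1 z₂ b₂)) =
          AlgPoints.map ((baseChangeHom τ).map (act k⁻¹).hom)
            (AlgPoints.baseChangeEquiv τ (S.M.obj N) ((S.pts N).symm (ShimuraSet.mk L H τ T hT N.1.1 z₁ b₁))) := by
        rw [hTτ, hN]
      rw [hP, ← AlgPoints.map_comp_apply, hπinv]
    · intro y
      obtain ⟨z, a, rfl⟩ := S.exists_eq_baseChangeEquiv_pts_symm_mk K y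
      refine ⟨AlgPoints.map ((baseChangeHom τ).map (autQuotient.mk actΔ hY))
        (AlgPoints.baseChangeEquiv τ (S.M.obj N) ((S.pts N).symm (ShimuraSet.mk L H τ T hT N.1.1 z a))), ?_⟩
      rw [← AlgPoints.map_comp_apply, hcomp, hpτ]
  exact isIso_of_bijective_of_isColimit_cofan ((baseChangeHom τ).map r) ι (fun _ => 2) (fun q => (B q).isSmoothProjective) hcol hbij

/-- **`levelQuotient_printed` HOLDS** ([Deligne1979ShimuraVarieties] 2.7.1 (c) for the canonical model of the compact unitary Shimura surface,
as typed in `UnitaryShimuraLevelQuotient.lean`; binders verbatim): a THEOREM of the record fields and the proved U7 — so every consumer's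
hypothesis `(hQ : levelQuotient_printed)` is discharged by `levelQuotient_printed_holds`.
[cite: Deligne1979ShimuraVarieties, 2.7.1 (c) (PDF p. 47 L34–38)] [cite: Milne2005ShimuraVarieties, Rem. 5.29 (c) p. 65 and Thm. 13.6 p. 118] -/
theorem levelQuotient_printed_holds : levelQuotient_printed :=
  fun _ _ _ _ _ _ _ _ hpos hanis _ htf S => RecordSystem.isLevelQuotient hpos hanis htf S

end Literature.AlgebraicGeometry.ShimuraVarieties.UnitaryCanonicalModel

end
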